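import Summits.Langlands.Langlands.Theorems.PhantomRMYoshidaResiduallyYoshidaLiftingGreenbergStablePlane
import Summits.Langlands.Langlands.Theorems.PhantomRMYoshidaResiduallyYoshidaLiftingInertiaFixedInOrdinaryPlane
import HarnessLib

/-!
# THE GREENBERG LINES OF `σ̄`, `σ̄'` CARRY DISTINCT `G_v`-CHARACTERS (stub `stub_greenbergLinesDistinguished`, PD-b) —
# line `sector-klingen-split`, crux `ResiduallyYoshidaLifting` (stmt-Langlands-13639)

Stub-worker file of lead prover-line-stmt-Langlands-13639-c5-0 (continuation c5, skeleton rev 14, sub-goal PD-b, 2026-08-17).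

**Theorem (`stub_greenbergLinesDistinguished`, registered signature verbatim).**  Let `ρ : Γ_ℚ → GL₄(ℚ̄_p)` be an
`Sh`-point (Greenberg-ordinary of shape `(0,0,1,1)` AND residually distinguished at `v ∣ p`) realising the cocycle `B`
through the integral frame `(P, rint)` with reduction conjugator `h`, on a `DetC` fibre, `p ≠ 2`.  Let `x₁ ≠ 0`, `y₁ ≠ 0`
span `G_v`-stable lines of `σ̄`, `σ̄'` with characters `a`, `b` trivial on `I_v`.  Then `a(τ) ≠ b(τ)` for some `τ`.

**Proof.**  (1) N1⁺ pipeline (`exists_greenbergMatrix`, T4 `stub_stablePlaneSaturation`): the Greenberg plane `M₀` of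
`ρ|Γ_{ℚ_v}`, moved to the integral frame and saturated, is an integral `N` with an identity block, STABLE (`rint(τ) N = N T_τ`,
`T_τ ∈ M₂(ℤ̄_p)`) and FIXED by `I_v`.  (2) Residual side (`charpoly_map_red_eq`): reduced and conjugated by `h⁻¹`, the plane
`(P'; Q')` of `k² ⊕ k²` is stable under `(σ̄ τ, B τ; 0, σ̄' τ)` with matrix `red T_τ` and fixed on `I_v`; an inertia element
with `ε̄ ≠ 1` moves both constituents (`DetC`), so inertia-fixed lines are UNIQUE: `Q' c₀ = 0 ≠ c₀`, `P' c₀ ∈ k x₁`,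
`Q'(k²) ⊆ k y₁`, and in the basis `(c₀, e)` the matrix `red T_τ` is `(a τ, *; 0, b τ)`: `charpoly (red T_τ) = (X - a τ)(X - b τ)`.
(3) `p`-adic side (`charpoly_eq_of_frame`): for the DISTINGUISHED frame `g'`, PD-a (`stub_inertiaFixedInOrdinaryPlane`) kills
the `g'`-coordinates `2, 3` of the inertia-fixed columns of `M₀ A`, so `g' M₀ A = (D; 0)`, `D` invertible, `U_τ D = D T_τ` for
the top-left block `U_τ = (ψ₀, *; 0, ψ₁)(τ)` of `g' ρ(τ) g'⁻¹`: `charpoly T_τ = (X - ψ₀(τ))(X - ψ₁(τ))`.  (4) `ne_of_charpoly_eq`: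
the `ψ_i` are roots of the monic integral `charpoly T_τ`, hence integral (`Valuation.Integers.mem_of_integral`); at the
distinguishing `τ₁`, `‖ψ₀ - ψ₁‖ = 1` makes `ψ₀ - ψ₁` a unit, so `ψ̄₀ ≠ ψ̄₁` are the roots of `(X - a)(X - b)`: `a(τ₁) ≠ b(τ₁)`.
No new definitions, no named fact taken as a hypothesis; Mathlib + the landed N1⁺ (p168218) and PD-a (p170254) files.
-/

noncomputable section

-- `Summit.Langlands.Langlands.…` (summit = sub-problem name, D-0017 layout) trips `dupNamespace` on every decl.
set_option linter.dupNamespace false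
set_option autoImplicit false

open IsDedekindDomain Filter Polynomial
open scoped Matrix
open Literature.NumberTheory.GaloisRepresentations Literature.NumberTheory.Automorphic
open Summit.Langlands.Langlands.Cruxes.ResiduallyYoshidaLifting.YoshidaDivisorSelmerCount
open Summit.Langlands.Langlands.Cruxes.StableYoshidaCongruence.BurkhardtWeddleTwoThreeAnchor
  (exists_mem_absInertia_epsBar_ne_one det_val_eq_of_det_eq)
open Summit.Langlands.Langlands.Cruxes.ResiduallyYoshidaLifting.EndoscopicCrossingEuler (mem_integer_iff_norm_le_one)

namespace Summit.Langlands.Langlands.Cruxes.ResiduallyYoshidaLifting.SectorKlingenSplit.Fibre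

/-- If a square matrix `T ≠ 1` fixes a square matrix `Q` under left multiplication (`T * Q = Q`), then `Q` is singular:
`Q *ᵥ c = 0` for some `c ≠ 0`. [folklore] -/
private theorem exists_mulVec_eq_zero_of_mul_eq {k : Type*} [Field k] {n : Type*} [Fintype n] [DecidableEq n]
    (T Q : Matrix n n k) (hT : T ≠ 1) (h : T * Q = Q) : ∃ c : n → k, c ≠ 0 ∧ Q *ᵥ c = 0 := by
  -- adapted from Theorems/…GreenbergStablePlane (p168218), private helper of the same name
  by_contra hc
  have hu : IsUnit Q.det := isUnit_iff_ne_zero.mpr fun h0 ↦ by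
    obtain ⟨v, hv, hQv⟩ := Matrix.exists_mulVec_eq_zero_iff.mpr h0
    exact hc ⟨v, hv, hQv⟩
  exact hT (calc T = T * Q * Q⁻¹ := (Matrix.mul_nonsing_inv_cancel_right Q T hu).symm
    _ = 1 := by rw [h, Matrix.mul_nonsing_inv Q hu])

/-- The kernel of a non-zero `2 × 2` matrix killing `c ≠ 0` is the line `k c`. [folklore] -/
private theorem exists_eq_smul_of_mulVec_eq_zero {k : Type*} [Field k] (Q : Matrix (Fin 2) (Fin 2) k) (hQ : Q ≠ 0)
    {c d : Fin 2 → k} (hc : c ≠ 0) (hQc : Q *ᵥ c = 0) (hQd : Q *ᵥ d = 0) : ∃ μ : k, d = μ • c := by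
  by_contra hne
  push Not at hne
  have hli : LinearIndependent k ![c, d] := by
    refine LinearIndependent.pair_iff.2 fun s t hst ↦ ?_
    by_cases ht : t = 0
    · rw [ht, zero_smul, add_zero] at hst
      exact ⟨(smul_eq_zero.1 hst).resolve_right hc, ht⟩
    · refine absurd ?_ (hne (-(t⁻¹ * s)))
      have h1 : t • d = -(s • c) := eq_neg_of_add_eq_zero_right hst
      calc d = t⁻¹ • (t • d) := by rw [smul_smul, inv_mul_cancel₀ ht, one_smul]
        _ = -(t⁻¹ * s) • c := by rw [h1, smul_neg, smul_smul, neg_smul]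
  let bs := basisOfLinearIndependentOfCardEqFinrank hli (by simp)
  have hb : ⇑bs = ![c, d] := coe_basisOfLinearIndependentOfCardEqFinrank _ _
  refine hQ (Matrix.ext_iff_mulVec.mpr fun v ↦ ?_)
  obtain ⟨α, β, rfl⟩ : ∃ α β : k, v = α • c + β • d :=
    ⟨bs.repr v 0, bs.repr v 1, by conv_lhs => rw [← bs.sum_repr v, Fin.sum_univ_two, hb]; simp⟩
  rw [Matrix.mulVec_add, Matrix.mulVec_smul, Matrix.mulVec_smul, hQc, hQd, smul_zero, smul_zero, add_zero,
    Matrix.zero_mulVec]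

/-- **Residual side.**  Let `N : O⁴ˣ²` carry an identity block in rows `i, j` and be STABLE under a family `R t` (`R t * N = N * T t`)
whose reductions are the realised block matrices `h (S t, B t; 0, S' t) h⁻¹`; let `x₁ ≠ 0`, `y₁ ≠ 0` span lines on which `S`, `S'`
act through `a`, `b`; let some `t₀` fix `N` with `S t₀ ≠ 1`, `S' t₀ ≠ 1`, `a t₀ = b t₀ = 1`.  Then `charpoly (red (T t)) = (X - a t)(X - b t)`
(the fixed lines are unique; in an adapted basis of the reduced plane `red (T t)` is triangular with diagonal `(a t, b t)`). [folklore] -/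
private theorem charpoly_map_red_eq {O : Type*} [CommRing O] {k : Type*} [Field k] {ι : Type*} (red : O →+* k)
    (R : ι → Matrix (Fin 4) (Fin 4) O) (N : Matrix (Fin 4) (Fin 2) O) (i j : Fin 4)
    (hNi0 : N i 0 = 1) (hNi1 : N i 1 = 0) (hNj0 : N j 0 = 0) (hNj1 : N j 1 = 1)
    (T : ι → Matrix (Fin 2) (Fin 2) O) (hT : ∀ t, R t * N = N * T t)
    (h : GL (Fin 4) k) (S S' B : ι → Matrix (Fin 2) (Fin 2) k)
    (hred : ∀ t, (R t).map red =
      h.val * Matrix.reindex finSumFinEquiv finSumFinEquiv (Matrix.fromBlocks (S t) (B t) 0 (S' t)) * (h⁻¹).val)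
    (x₁ y₁ : Fin 2 → k) (a b : ι → k) (hx : x₁ ≠ 0) (hy : y₁ ≠ 0)
    (ha : ∀ t, S t *ᵥ x₁ = a t • x₁) (hb : ∀ t, S' t *ᵥ y₁ = b t • y₁)
    (t₀ : ι) (hR₀ : R t₀ * N = N) (hS₀ : S t₀ ≠ 1) (hS'₀ : S' t₀ ≠ 1) (ha₀ : a t₀ = 1) (hb₀ : b t₀ = 1) (t : ι) :
    ((T t).map red).charpoly = (X - C (a t)) * (X - C (b t)) := by
  -- transport (as in N1⁺): `red N` has rank `2`; `N' := h⁻¹ (red N)` on `k² ⊕ k²` is stable with matrix `red (T t)`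
  have hinj : ∀ v : Fin 2 → k, N.map red *ᵥ v = 0 → v = 0 := fun v hv ↦ by
    have hij := And.intro (congrFun hv i) (congrFun hv j)
    simp only [Matrix.mulVec, dotProduct, Fin.sum_univ_two, Matrix.map_apply, hNi0, hNi1, hNj0, hNj1, map_one, map_zero,
      one_mul, zero_mul, add_zero, zero_add, Pi.zero_apply] at hij
    exact funext fun c ↦ by fin_cases c <;> simp [hij]
  set eσ : Fin 2 ⊕ Fin 2 ≃ Fin 4 := finSumFinEquiv with heσ
  have hF : ∀ t, (Matrix.reindex eσ eσ (Matrix.fromBlocks (S t) (B t) 0 (S' t))).submatrix eσ eσ =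
      Matrix.fromBlocks (S t) (B t) 0 (S' t) := fun t ↦ by
    rw [Matrix.reindex_apply, Matrix.submatrix_submatrix, Equiv.symm_comp_self, Matrix.submatrix_id_id]
  have hconj : ∀ t, (h⁻¹).val * (R t).map red = Matrix.reindex eσ eσ (Matrix.fromBlocks (S t) (B t) 0 (S' t)) * (h⁻¹).val :=
    fun t ↦ by rw [hred, ← Matrix.mul_assoc, ← Matrix.mul_assoc, Units.inv_mul, Matrix.one_mul]
  obtain ⟨N', hN'⟩ : ∃ N' : Matrix (Fin 2 ⊕ Fin 2) (Fin 2) k, N' = ((h⁻¹).val * N.map red).submatrix eσ id := ⟨_, rfl⟩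
  have hstab' : ∀ t, Matrix.fromBlocks (S t) (B t) 0 (S' t) * N' = N' * (T t).map red := fun t ↦ by
    have e1 : (h⁻¹).val * (R t * N).map red = (h⁻¹).val * (N * T t).map red := by rw [hT]
    rw [Matrix.map_mul, Matrix.map_mul, ← Matrix.mul_assoc, hconj, Matrix.mul_assoc, ← Matrix.mul_assoc (h⁻¹).val] at e1
    rw [← hF t, hN', Matrix.submatrix_mul_equiv, e1]
    rfl
  have hfix' : Matrix.fromBlocks (S t₀) (B t₀) 0 (S' t₀) * N' = N' := by
    have e1 : (h⁻¹).val * (R t₀ * N).map red = (h⁻¹).val * N.map red := by rw [hR₀]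
    rw [Matrix.map_mul, ← Matrix.mul_assoc, hconj, Matrix.mul_assoc] at e1
    rw [← hF t₀, hN', Matrix.submatrix_mul_equiv, e1]
  have hinj' : ∀ v : Fin 2 → k, N' *ᵥ v = 0 → v = 0 := fun v hv ↦ by
    have h1 : ((h⁻¹).val * N.map red) *ᵥ v = 0 := by
      rw [hN'] at hv
      change (((h⁻¹).val * N.map red) *ᵥ v) ∘ ⇑eσ = 0 at hv
      simpa only [funext_iff, eσ.surjective.forall, Function.comp_apply, Pi.zero_apply] using hv
    refine hinj v ?_
    calc N.map red *ᵥ v = h.val *ᵥ (((h⁻¹).val * N.map red) *ᵥ v) := by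
          rw [Matrix.mulVec_mulVec, ← Matrix.mul_assoc, Units.mul_inv, Matrix.one_mul]
      _ = 0 := by rw [h1, Matrix.mulVec_zero]
  -- `N' = (P; Q)`: stability and fixedness in blocks
  obtain ⟨P, Q, rfl⟩ : ∃ P Q : Matrix (Fin 2) (Fin 2) k, N' = Matrix.fromRows P Q :=
    ⟨N'.toRows₁, N'.toRows₂, (Matrix.fromRows_toRows N').symm⟩
  have hPQ : ∀ v : Fin 2 → k, P *ᵥ v = 0 → Q *ᵥ v = 0 → v = 0 := fun v hPv hQv ↦
    hinj' v (by rw [Matrix.fromRows_mulVec, hPv, hQv, Sum.elim_zero_zero])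
  have hst : ∀ t, S t * P + B t * Q = P * (T t).map red ∧ S' t * Q = Q * (T t).map red := fun t ↦ by
    simpa only [Matrix.fromBlocks_mul_fromRows, Matrix.fromRows_mul, Matrix.fromRows_ext_iff, Matrix.zero_mul, zero_add]
      using hstab' t
  have hfx : S t₀ * P + B t₀ * Q = P ∧ S' t₀ * Q = Q := by
    simpa only [Matrix.fromBlocks_mul_fromRows, Matrix.fromRows_ext_iff, Matrix.zero_mul, zero_add] using hfix'
  -- `Q c₀ = 0 ≠ c₀`, `P c₀ ≠ 0`; `Q e ≠ 0`
  obtain ⟨c₀, hc₀, hQc⟩ := exists_mulVec_eq_zero_of_mul_eq (S' t₀) Q hS'₀ hfx.2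
  have hx₁' : P *ᵥ c₀ ≠ 0 := fun h0 ↦ hc₀ (hPQ c₀ h0 hQc)
  obtain ⟨e, he⟩ : ∃ e : Fin 2 → k, Q *ᵥ e ≠ 0 := by
    by_contra h0
    push Not at h0
    have hQ0 : Q = 0 := Matrix.ext_iff_mulVec.mpr fun v ↦ by rw [h0 v, Matrix.zero_mulVec]
    obtain ⟨d, hd, hPd⟩ := exists_mulVec_eq_zero_of_mul_eq (S t₀) P hS₀
      (by simpa only [hQ0, Matrix.mul_zero, add_zero] using hfx.1)
    exact hd (hPQ d hPd (by rw [hQ0, Matrix.zero_mulVec]))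
  have hQ0 : Q ≠ 0 := fun h0 ↦ he (by rw [h0, Matrix.zero_mulVec])
  -- uniqueness of the inertia-fixed lines: `P c₀ ∈ k x₁`, `Q (k²) ⊆ k y₁`
  have hsub : ∀ (Y : Matrix (Fin 2) (Fin 2) k) (w : Fin 2 → k), Y *ᵥ w = w → (Y - 1) *ᵥ w = 0 := fun Y w hw ↦ by
    rw [Matrix.sub_mulVec, hw, Matrix.one_mulVec, sub_self]
  obtain ⟨μ, hμ⟩ : ∃ μ : k, P *ᵥ c₀ = μ • x₁ := by
    refine exists_eq_smul_of_mulVec_eq_zero (S t₀ - 1) (sub_ne_zero.2 hS₀) hx (hsub _ _ ?_) (hsub _ _ ?_)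
    · rw [ha, ha₀, one_smul]
    · calc S t₀ *ᵥ (P *ᵥ c₀) = (S t₀ * P + B t₀ * Q) *ᵥ c₀ := by
            rw [Matrix.add_mulVec, Matrix.mulVec_mulVec, ← Matrix.mulVec_mulVec c₀ (B t₀) Q, hQc, Matrix.mulVec_zero,
              add_zero]
        _ = P *ᵥ c₀ := by rw [hfx.1]
  have hν : ∀ d, ∃ ν : k, Q *ᵥ d = ν • y₁ := fun d ↦ by
    refine exists_eq_smul_of_mulVec_eq_zero (S' t₀ - 1) (sub_ne_zero.2 hS'₀) hy (hsub _ _ ?_) (hsub _ _ ?_)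
    · rw [hb, hb₀, one_smul]
    · rw [Matrix.mulVec_mulVec, hfx.2]
  -- the reduced matrix `T'` in the basis `(c₀, e)`: `T' c₀ = a c₀`, `T' e = γ c₀ + b e`
  set T' : Matrix (Fin 2) (Fin 2) k := (T t).map red with hT'
  have hSP : S t *ᵥ (P *ᵥ c₀) = a t • (P *ᵥ c₀) := by rw [hμ, Matrix.mulVec_smul, ha, smul_comm]
  have hS'Q : ∀ d, S' t *ᵥ (Q *ᵥ d) = b t • (Q *ᵥ d) := fun d ↦ by
    obtain ⟨ν, hν⟩ := hν d
    rw [hν, Matrix.mulVec_smul, hb, smul_comm]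
  have hTc : T' *ᵥ c₀ = a t • c₀ := by
    rw [← sub_eq_zero]
    refine hPQ _ ?_ ?_
    · rw [Matrix.mulVec_sub, Matrix.mulVec_smul, Matrix.mulVec_mulVec, ← (hst t).1, Matrix.add_mulVec,
        ← Matrix.mulVec_mulVec, ← Matrix.mulVec_mulVec, hQc, Matrix.mulVec_zero, add_zero, hSP, sub_self]
    · rw [Matrix.mulVec_sub, Matrix.mulVec_smul, hQc, smul_zero, sub_zero, Matrix.mulVec_mulVec, ← (hst t).2,
        ← Matrix.mulVec_mulVec, hQc, Matrix.mulVec_zero]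
  obtain ⟨γ, hγ⟩ : ∃ γ : k, T' *ᵥ e - b t • e = γ • c₀ :=
    exists_eq_smul_of_mulVec_eq_zero Q hQ0 hc₀ hQc (by
      rw [Matrix.mulVec_sub, Matrix.mulVec_smul, Matrix.mulVec_mulVec, ← (hst t).2, ← Matrix.mulVec_mulVec, hS'Q,
        sub_self])
  have hTe : T' *ᵥ e = γ • c₀ + b t • e := by rw [← hγ, sub_add_cancel]
  -- the basis matrix `Cb = (c₀ | e)` is invertible and `T' Cb = Cb U` with `U = (a t, γ; 0, b t)`
  set Cb : Matrix (Fin 2) (Fin 2) k := Matrix.of fun r s ↦ ![c₀, e] s r with hCb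
  have hCbv : ∀ v, Cb *ᵥ v = v 0 • c₀ + v 1 • e := fun v ↦ by
    ext r
    simp [hCb, Matrix.mulVec, dotProduct, Fin.sum_univ_two, mul_comm]
  have hCbu : IsUnit Cb.det := isUnit_iff_ne_zero.2 fun h0 ↦ by
    obtain ⟨v, hv, hCv⟩ := Matrix.exists_mulVec_eq_zero_iff.2 h0
    rw [hCbv] at hCv
    have hv1 : v 1 = 0 := by
      have hQ := congrArg (Q *ᵥ ·) hCv
      simp only [Matrix.mulVec_add, Matrix.mulVec_smul, hQc, smul_zero, zero_add, Matrix.mulVec_zero] at hQ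
      exact (smul_eq_zero.1 hQ).resolve_right he
    rw [hv1, zero_smul, add_zero] at hCv
    exact hv (funext fun l ↦ by fin_cases l <;> simp [hv1, (smul_eq_zero.1 hCv).resolve_right hc₀])
  set U : Matrix (Fin 2) (Fin 2) k := !![a t, γ; 0, b t] with hU
  have hTU : T' * Cb = Cb * U := by
    ext r s
    have h0 := congrFun hTc r
    have h1 := congrFun hTe r
    simp only [Matrix.mulVec, dotProduct, Fin.sum_univ_two, Pi.add_apply, Pi.smul_apply, smul_eq_mul] at h0 h1
    fin_cases s
    · simp [Matrix.mul_apply, Fin.sum_univ_two, hCb, hU]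
      linear_combination h0
    · simp [Matrix.mul_apply, Fin.sum_univ_two, hCb, hU]
      linear_combination h1
  have hT'eq : T' = Cb * U * Cb⁻¹ := by rw [← hTU, Matrix.mul_nonsing_inv_cancel_right Cb T' hCbu]
  rw [hT'eq, Matrix.charpoly_mul_comm, ← Matrix.mul_assoc, Matrix.nonsing_inv_mul Cb hCbu, Matrix.one_mul,
    Matrix.charpoly_of_upperTriangular U (by intro r s hrs; fin_cases r <;> fin_cases s <;> simp [hU] at hrs ⊢),
    Fin.prod_univ_two]
  simp [hU]

/-- **`p`-adic side.**  Let `ρ : Γ_{ℚ_v} → GL₄(ℚ̄_p)` (`v ∣ p`, `p ≠ 2`) admit a frame `g` upper triangular on `Γ_{ℚ_v}`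
with inertial diagonal `(1, 1, ε⁻¹, ε⁻¹)`, and let `M : ℚ̄_p⁴ˣ²` be injective with inertia-fixed columns and stable plane:
`ρ(τ) M = M T_τ`.  Then `charpoly T_τ = (X - (g ρ(τ) g⁻¹)₀₀) (X - (g ρ(τ) g⁻¹)₁₁)`: by PD-a the rows `2, 3` of `g M`
vanish, its top block `D` is invertible, and `U_τ D = D T_τ` for the top-left block `U_τ` of `g ρ(τ) g⁻¹`. [folklore] -/
private theorem charpoly_eq_of_frame {p : ℕ} [Fact p.Prime] (hp : p ≠ 2)
    (v : HeightOneSpectrum (NumberField.RingOfIntegers ℚ)) (hv : ((p : ℕ) : NumberField.RingOfIntegers ℚ) ∈ v.asIdeal)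
    (ρ : FramedRep (Field.absoluteGaloisGroup (v.adicCompletion ℚ)) (PadicAlgCl p) 4) (g : GL (Fin 4) (PadicAlgCl p))
    (hup : ∀ (τ : Field.absoluteGaloisGroup (v.adicCompletion ℚ)) (i j : Fin 4), j < i →
      ((g * ρ τ * g⁻¹ : GL (Fin 4) (PadicAlgCl p)) : Matrix (Fin 4) (Fin 4) (PadicAlgCl p)) i j = 0)
    (hdiag : ∀ τ ∈ absInertia (v.adicCompletion ℚ), ∀ i : Fin 4,
      ((g * ρ τ * g⁻¹ : GL (Fin 4) (PadicAlgCl p)) : Matrix (Fin 4) (Fin 4) (PadicAlgCl p)) i i =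
        algebraMap ℚ_[p] (PadicAlgCl p)
          ((((GaloisRep.cyclotomicCharacter (v.adicCompletion ℚ) p τ)⁻¹ : ℤ_[p]ˣ) : ℤ_[p]) : ℚ_[p]) ^ (![0, 0, 1, 1] i : ℕ))
    (M : Matrix (Fin 4) (Fin 2) (PadicAlgCl p)) (hinj : ∀ u : Fin 2 → PadicAlgCl p, M *ᵥ u = 0 → u = 0)
    (hfix : ∀ τ ∈ absInertia (v.adicCompletion ℚ), (ρ τ).val * M = M)
    (T : Field.absoluteGaloisGroup (v.adicCompletion ℚ) → Matrix (Fin 2) (Fin 2) (PadicAlgCl p))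
    (hT : ∀ τ, (ρ τ).val * M = M * T τ) (τ : Field.absoluteGaloisGroup (v.adicCompletion ℚ)) :
    (T τ).charpoly =
      (X - C (((g * ρ τ * g⁻¹ : GL (Fin 4) (PadicAlgCl p)) : Matrix (Fin 4) (Fin 4) (PadicAlgCl p)) 0 0)) *
        (X - C (((g * ρ τ * g⁻¹ : GL (Fin 4) (PadicAlgCl p)) : Matrix (Fin 4) (Fin 4) (PadicAlgCl p)) 1 1)) := by
  -- `G := g M` has vanishing rows `2, 3` (PD-a: the columns of `M` are inertia-fixed)
  set G : Matrix (Fin 4) (Fin 2) (PadicAlgCl p) := g.val * M with hG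
  have hG23 : ∀ c, G 2 c = 0 ∧ G 3 c = 0 := fun c ↦ by
    have hw : ∀ τ' ∈ absInertia (v.adicCompletion ℚ), (ρ τ').val *ᵥ (M *ᵥ Pi.single c 1) = M *ᵥ Pi.single c 1 :=
      fun τ' hτ' ↦ by rw [Matrix.mulVec_mulVec, hfix τ' hτ']
    have h23 := stub_inertiaFixedInOrdinaryPlane p hp v hv ρ g hup hdiag (M *ᵥ Pi.single c 1) hw
    rwa [Matrix.mulVec_mulVec, Matrix.mulVec_single_one] at h23
  -- `A := g ρ(τ) g⁻¹` acts on `G` through `T τ`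
  set A : Matrix (Fin 4) (Fin 4) (PadicAlgCl p) :=
    ((g * ρ τ * g⁻¹ : GL (Fin 4) (PadicAlgCl p)) : Matrix (Fin 4) (Fin 4) (PadicAlgCl p)) with hA
  have hAG : A * G = G * T τ := by
    rw [hA, hG, ← Matrix.mul_assoc, ← Units.val_mul, inv_mul_cancel_right, Units.val_mul, Matrix.mul_assoc, hT,
      Matrix.mul_assoc]
  have hA10 : A 1 0 = 0 := hup τ 1 0 (by decide)
  -- the top block `D` of `G` and the top-left block `U` of `A`: `U D = D T`
  set D : Matrix (Fin 2) (Fin 2) (PadicAlgCl p) := !![G 0 0, G 0 1; G 1 0, G 1 1] with hD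
  set U : Matrix (Fin 2) (Fin 2) (PadicAlgCl p) := !![A 0 0, A 0 1; 0, A 1 1] with hU
  have hUD : U * D = D * T τ := by
    have e := fun r c ↦ congrFun (congrFun hAG r) c
    simp only [Matrix.mul_apply, Fin.sum_univ_four, Fin.sum_univ_two, (hG23 _).1, (hG23 _).2, mul_zero, add_zero] at e
    ext r c
    fin_cases r <;> fin_cases c
    · simpa [hU, hD, Matrix.mul_apply, Fin.sum_univ_two] using e 0 0
    · simpa [hU, hD, Matrix.mul_apply, Fin.sum_univ_two] using e 0 1
    · simpa [hU, hD, Matrix.mul_apply, Fin.sum_univ_two, hA10] using e 1 0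
    · simpa [hU, hD, Matrix.mul_apply, Fin.sum_univ_two, hA10] using e 1 1
  -- `D` is invertible (`M` injective, `g` invertible, rows `2, 3` of `G` vanish)
  have hDu : IsUnit D.det := isUnit_iff_ne_zero.2 fun h0 ↦ by
    obtain ⟨u, hu, hDu⟩ := Matrix.exists_mulVec_eq_zero_iff.2 h0
    have hGu : G *ᵥ u = 0 := by
      have e := fun r ↦ congrFun hDu r
      ext r
      fin_cases r
      · simpa [hD, Matrix.mulVec, dotProduct, Fin.sum_univ_two] using e 0
      · simpa [hD, Matrix.mulVec, dotProduct, Fin.sum_univ_two] using e 1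
      · simp [Matrix.mulVec, dotProduct, (hG23 _).1]
      · simp [Matrix.mulVec, dotProduct, (hG23 _).2]
    refine hu (hinj u ?_)
    calc M *ᵥ u = (g⁻¹).val *ᵥ (G *ᵥ u) := by
          rw [hG, Matrix.mulVec_mulVec, ← Matrix.mul_assoc, Units.inv_mul, Matrix.one_mul]
      _ = 0 := by rw [hGu, Matrix.mulVec_zero]
  -- `T τ = D⁻¹ U D`, so `charpoly (T τ) = charpoly U`
  have hTeq : T τ = D⁻¹ * (U * D) := by rw [hUD, Matrix.nonsing_inv_mul_cancel_left D _ hDu]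
  rw [hTeq, Matrix.charpoly_mul_comm, Matrix.mul_nonsing_inv_cancel_right D U hDu,
    Matrix.charpoly_of_upperTriangular U (by intro r s hrs; fin_cases r <;> fin_cases s <;> simp [hU] at hrs ⊢),
    Fin.prod_univ_two]
  simp [hU]

/-- **Comparison.**  If an integral `2 × 2` matrix `T` has `charpoly (red T) = (X - α)(X - β)` over `k` and `charpoly T = (X - ψ₀)(X - ψ₁)`
over `ℚ̄_p` with `‖ψ₀ - ψ₁‖ = 1`, then `α ≠ β`: the roots `ψ_i` are integral (`ℤ̄_p` is integrally closed), `charpoly T = (X - ψ₀)(X - ψ₁)`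
over `ℤ̄_p`, `ψ₀ - ψ₁` is a unit, so the reductions `ψ̄₀ ≠ ψ̄₁` are the roots of `(X - α)(X - β)`. [folklore] -/
private theorem ne_of_charpoly_eq {p : ℕ} [Fact p.Prime] {k : Type*} [Field k]
    (red : Valued.integer (PadicAlgCl p) →+* k) (T : Matrix (Fin 2) (Fin 2) (Valued.integer (PadicAlgCl p)))
    (α β : k) (ψ₀ ψ₁ : PadicAlgCl p) (hk : (T.map red).charpoly = (X - C α) * (X - C β))
    (hK : (T.map (Valued.integer (PadicAlgCl p)).subtype).charpoly = (X - C ψ₀) * (X - C ψ₁))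
    (hdist : ‖ψ₀ - ψ₁‖ = 1) : α ≠ β := by
  -- the roots of the monic integral `charpoly T` are integral
  have hint : ∀ ψ : PadicAlgCl p, ((X - C ψ₀) * (X - C ψ₁)).eval ψ = 0 → ψ ∈ Valued.integer (PadicAlgCl p) :=
    fun ψ hψ ↦ Valuation.Integers.mem_of_integral (Valuation.integer.integers _)
      ⟨T.charpoly, Matrix.charpoly_monic T, by
        rwa [← Polynomial.eval_map, Algebra.algebraMap_ofSubring, ← Matrix.charpoly_map, hK]⟩
  obtain ⟨φ₀, rfl⟩ : ∃ φ₀ : Valued.integer (PadicAlgCl p), (φ₀ : PadicAlgCl p) = ψ₀ := ⟨⟨ψ₀, hint ψ₀ (by simp)⟩, rfl⟩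
  obtain ⟨φ₁, rfl⟩ : ∃ φ₁ : Valued.integer (PadicAlgCl p), (φ₁ : PadicAlgCl p) = ψ₁ := ⟨⟨ψ₁, hint ψ₁ (by simp)⟩, rfl⟩
  -- `charpoly T = (X - φ₀)(X - φ₁)` over `ℤ̄_p`; reduce
  have hO : T.charpoly = (X - C φ₀) * (X - C φ₁) := by
    apply Polynomial.map_injective (Valued.integer (PadicAlgCl p)).subtype Subtype.val_injective
    rw [← Matrix.charpoly_map, hK]
    simp [Polynomial.map_mul, Polynomial.map_sub]
  have hkO : (X - C α) * (X - C β) = (X - C (red φ₀)) * (X - C (red φ₁)) := by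
    rw [← hk, Matrix.charpoly_map, hO]
    simp [Polynomial.map_mul, Polynomial.map_sub]
  -- `φ₀ - φ₁` is a unit of `ℤ̄_p`, so `red φ₀ ≠ red φ₁`
  have hne : red φ₀ ≠ red φ₁ := by
    have hψ : (φ₀ : PadicAlgCl p) - φ₁ ≠ 0 := fun h0 ↦ by simp [h0] at hdist
    have hu : IsUnit (φ₀ - φ₁) := IsUnit.of_mul_eq_one
      (⟨((φ₀ : PadicAlgCl p) - φ₁)⁻¹, (mem_integer_iff_norm_le_one _).2 (by rw [norm_inv, hdist, inv_one])⟩ :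
        Valued.integer (PadicAlgCl p)) (Subtype.ext (by push_cast; exact mul_inv_cancel₀ hψ))
    have h1 := (hu.map red).ne_zero
    rwa [map_sub, sub_ne_zero] at h1
  intro hαβ
  rw [hαβ] at hkO
  have e0 := congrArg (Polynomial.eval (red φ₀)) hkO
  have e1 := congrArg (Polynomial.eval (red φ₁)) hkO
  simp only [Polynomial.eval_mul, Polynomial.eval_sub, Polynomial.eval_X, Polynomial.eval_C, sub_self, zero_mul,
    mul_zero] at e0 e1
  exact hne ((sub_eq_zero.1 (mul_self_eq_zero.1 e0)).trans (sub_eq_zero.1 (mul_self_eq_zero.1 e1)).symm)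

/-- **Registered sub-goal PD-b `stub_greenbergLinesDistinguished`** (crux stmt-Langlands-13639, line `sector-klingen-split`,
skeleton rev 14): for an `Sh`-point `ρ` (Greenberg-ordinary of shape `(0,0,1,1)` AND residually distinguished at `v ∣ p`)
realising `B` through an integral frame on a `DetC` fibre (`p ≠ 2`), and for ANY non-zero `x₁ ∈ σ̄`, `y₁ ∈ σ̄'` spanning
`G_v`-stable lines fixed by `I_v` (the Greenberg lines of N1⁺), the `G_v`-characters `a, b` on `k x₁`, `k y₁` are
DISTINCT: `a(τ) ≠ b(τ)` for some `τ`.  (The inertia-fixed lines are unique; `rint(τ)` acts on the saturated Greenberg plane through an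
integral `T_τ` with `red T_τ ∼ (a, *; 0, b)` and `charpoly T_τ = (X - ψ₀(τ))(X - ψ₁(τ))` for the weight-`0` diagonal characters of the
DISTINGUISHED frame, whose plane is the Greenberg plane by PD-a; `‖ψ₀(τ₁) - ψ₁(τ₁)‖ = 1` gives `a(τ₁) ≠ b(τ₁)`.) [folklore] -/
theorem stub_greenbergLinesDistinguished :
    ∀ (p : ℕ) [Fact p.Prime], p ≠ 2 → ∀ (k : Type) [Field k] [CharP k p] [IsAlgClosed k]
      [TopologicalSpace k] [DiscreteTopology k] (red : Valued.integer (PadicAlgCl p) →+* k)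
      (σ σ' : FramedGaloisRep ℚ k 2) (ρ : FramedGaloisRep ℚ (PadicAlgCl p) 4)
      (P : GL (Fin 4) (PadicAlgCl p))
      (rint : Field.absoluteGaloisGroup ℚ →* GL (Fin 4) (Valued.integer (PadicAlgCl p))) (h : GL (Fin 4) k)
      (B : Field.absoluteGaloisGroup ℚ → Matrix (Fin 2) (Fin 2) k)
      (v : HeightOneSpectrum (NumberField.RingOfIntegers ℚ)),
      ((p : ℕ) : NumberField.RingOfIntegers ℚ) ∈ v.asIdeal → DetC p k σ σ' → Sh p k red σ σ' ρ →
      (∀ g, Matrix.GeneralLinearGroup.map (Valued.integer (PadicAlgCl p)).subtype (rint g) = P⁻¹ * ρ g * P) →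
      (∀ g, (Matrix.GeneralLinearGroup.map red (rint g)).val =
          h.val * Matrix.reindex finSumFinEquiv finSumFinEquiv
            (Matrix.fromBlocks (σ g).val (B g) 0 (σ' g).val) * (h⁻¹).val) →
      ∀ (x₁ y₁ : Fin 2 → k) (a b : Field.absoluteGaloisGroup (v.adicCompletion ℚ) → k), x₁ ≠ 0 → y₁ ≠ 0 →
      (∀ τ, (σ (absGaloisRestrict ℚ (v.adicCompletion ℚ) τ)).val *ᵥ x₁ = a τ • x₁) →
      (∀ τ, (σ' (absGaloisRestrict ℚ (v.adicCompletion ℚ) τ)).val *ᵥ y₁ = b τ • y₁) →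
      (∀ τ ∈ absInertia (v.adicCompletion ℚ), a τ = 1) → (∀ τ ∈ absInertia (v.adicCompletion ℚ), b τ = 1) →
      ∃ τ, a τ ≠ b τ := by
  intro p _ hp k _ _ _ _ _ red σ σ' ρ P rint h B v hv hDet hSh hP hred x₁ y₁ a b hx hy ha hb haI hbI
  -- the integral frame over `ℚ̄_p`, as a plain matrix family; `L` = restriction to `Γ_{ℚ_v}`
  have hPval : ∀ g, (rint g).val.map (Valued.integer (PadicAlgCl p)).subtype = (P⁻¹).val * (ρ g).val * P.val := fun g ↦ by
    have e := congrArg Units.val (hP g)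
    rwa [Units.val_mul, Units.val_mul] at e
  set L := absGaloisRestrict ℚ (v.adicCompletion ℚ) with hL
  -- Step 1 (N1⁺ pipeline): Greenberg plane `M₀`, integral frame `M₁ := P⁻¹ M₀`, saturation `N = M₁ A` keeping stability
  obtain ⟨M₀, hM₀inj, hM₀stab, hM₀I⟩ := exists_greenbergMatrix (ρ.toLocal v) (hSh.2.1 v hv).1
  obtain ⟨M₁, hM₁⟩ : ∃ M₁ : Matrix (Fin 4) (Fin 2) (PadicAlgCl p), M₁ = (P⁻¹).val * M₀ := ⟨_, rfl⟩
  have hinj : ∀ u : Fin 2 → PadicAlgCl p, M₁ *ᵥ u = 0 → u = 0 := fun u hu ↦ hM₀inj u <| by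
    calc M₀ *ᵥ u = P.val *ᵥ (M₁ *ᵥ u) := by rw [hM₁, Matrix.mulVec_mulVec, ← Matrix.mul_assoc, Units.mul_inv, Matrix.one_mul]
      _ = 0 := by rw [hu, Matrix.mulVec_zero]
  have hact : ∀ τ, (rint (L τ)).val.map (Valued.integer (PadicAlgCl p)).subtype * M₁ = (P⁻¹).val * ((ρ.toLocal v τ).val * M₀) :=
    fun τ ↦ by rw [hPval, hM₁, Matrix.mul_assoc, ← Matrix.mul_assoc P.val, Units.mul_inv, Matrix.one_mul, Matrix.mul_assoc]; rfl
  have hstab : ∀ τ, ∃ T : Matrix (Fin 2) (Fin 2) (PadicAlgCl p), (rint (L τ)).val.map (Valued.integer (PadicAlgCl p)).subtype * M₁ =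
      M₁ * T := fun τ ↦ (hM₀stab τ).imp fun T hT ↦ by rw [hact τ, hT, hM₁, Matrix.mul_assoc]
  obtain ⟨N, A, i, j, T, -, hNi0, hNi1, hNj0, hNj1, hA, hNA, hNT⟩ :=
    stub_stablePlaneSaturation p (Field.absoluteGaloisGroup (v.adicCompletion ℚ)) (fun τ ↦ (rint (L τ)).val) M₁ hinj hstab
  -- inertia fixes `N`
  have hI : ∀ τ ∈ absInertia (v.adicCompletion ℚ), (rint (L τ)).val * N = N := fun τ hτ ↦ by
    apply Matrix.map_injective (Valued.integer (PadicAlgCl p)).subtype_injective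
    show ((rint (L τ)).val * N).map _ = N.map _
    rw [Matrix.map_mul, hNA, ← Matrix.mul_assoc, hact τ, (hM₀I τ hτ).1, hM₁]
  -- an inertia element `τ₀` with `ε̄(τ₀) ≠ 1` moves both constituents (`det = ε̄⁻¹`)
  obtain ⟨τ₀, hτ₀I, hτ₀⟩ := exists_mem_absInertia_epsBar_ne_one hp v hv
  have hmove : ∀ s : FramedGaloisRep ℚ k 2,
      (∀ g, FramedRep.det s g = (Units.map (ZMod.castHom (dvd_refl p) k).toMonoidHom (εb p g))⁻¹) → (s (L τ₀)).val ≠ 1 :=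
      fun s hs h1 ↦ by
    have h2 := det_val_eq_of_det_eq (hs (L τ₀))
    rw [h1, Matrix.det_one, eq_comm, map_eq_one_iff _ (ZMod.castHom_injective k), Units.val_eq_one, inv_eq_one] at h2
    exact hτ₀ h2
  -- Step 2 (residual side): `charpoly (red T_τ) = (X - a τ)(X - b τ)`
  have hres : ∀ τ, ((T τ).map red).charpoly = (X - C (a τ)) * (X - C (b τ)) :=
    charpoly_map_red_eq red (fun τ ↦ (rint (L τ)).val) N i j hNi0 hNi1 hNj0 hNj1 T hNT h (fun τ ↦ (σ (L τ)).val)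
      (fun τ ↦ (σ' (L τ)).val) (fun τ ↦ B (L τ)) (fun τ ↦ hred _) x₁ y₁ a b hx hy ha hb τ₀ (hI τ₀ hτ₀I)
      (hmove σ fun g ↦ (hDet g).1) (hmove σ' fun g ↦ (hDet g).2.trans (hDet g).1) (haI τ₀ hτ₀I) (hbI τ₀ hτ₀I)
  -- Step 3 (`p`-adic side): the plane `M₀ A` is stable with matrix `T_τ` and inertia-fixed; distinguished frame `g'`
  have hTK : ∀ τ, (ρ.toLocal v τ).val * (M₀ * A) = M₀ * A * (T τ).map (Valued.integer (PadicAlgCl p)).subtype := fun τ ↦ by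
    have e : ((rint (L τ)).val * N).map (Valued.integer (PadicAlgCl p)).subtype =
        (N * T τ).map (Valued.integer (PadicAlgCl p)).subtype := by rw [hNT τ]
    rw [Matrix.map_mul, Matrix.map_mul, hNA, ← Matrix.mul_assoc, hact τ, hM₁] at e
    have e2 := congrArg (fun X : Matrix (Fin 4) (Fin 2) (PadicAlgCl p) ↦ P.val * X) e
    simpa only [← Matrix.mul_assoc, Units.mul_inv, Matrix.one_mul] using e2
  have hinjA : ∀ u : Fin 2 → PadicAlgCl p, (M₀ * A) *ᵥ u = 0 → u = 0 := fun u hu ↦ by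
    have hAu : A *ᵥ u = 0 := hM₀inj _ (by rwa [Matrix.mulVec_mulVec])
    rw [← Matrix.one_mulVec u, ← Matrix.nonsing_inv_mul A hA, ← Matrix.mulVec_mulVec, hAu, Matrix.mulVec_zero]
  have hfixA : ∀ τ ∈ absInertia (v.adicCompletion ℚ), (ρ.toLocal v τ).val * (M₀ * A) = M₀ * A := fun τ hτ ↦ by
    rw [← Matrix.mul_assoc, (hM₀I τ hτ).1]
  obtain ⟨g', hup', hdiag', hdist'⟩ := (hSh.2.1 v hv).2
  obtain ⟨τ₁, hτ₁⟩ := hdist' 0 1 (by decide) rfl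
  -- Step 4: compare the two characteristic polynomials at the distinguishing `τ₁`
  exact ⟨τ₁, ne_of_charpoly_eq red (T τ₁) (a τ₁) (b τ₁) _ _ (hres τ₁)
    (charpoly_eq_of_frame hp v hv (ρ.toLocal v) g' hup' hdiag' (M₀ * A) hinjA hfixA _ hTK τ₁) hτ₁⟩

end Summit.Langlands.Langlands.Cruxes.ResiduallyYoshidaLifting.SectorKlingenSplit.Fibre

end
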